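import Literature.Barriers.CriticalPhenomena.HvdHTorusShift
import HarnessLib

/-!
# The trilinear shifted random-walk integrals of the percolation bootstrap
# (Heydenreich–van der Hofstad 2017, Exercise 5.4 (5.4.6)–(5.4.7), Lemma 8.6 (8.3.22), (8.3.30))

Sibling of `HvdHRandomWalkTriangles.lean` and `HvdHTorusShift.lean` (barrier catalogue
`Literature/Barriers/CriticalPhenomena/`), a leaf below the named fact `HvdH2017_prop83`. In the
improvement of the bounds, the bootstrap hypotheses `f₂(p) ≤ K`, `f₃(p) ≤ K` turn the Fourier
diagrams of Lemma 8.6 into the integrals ((8.3.22), and (8.3.30) without the weight `D̂²`)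

`∫ D̂(l)² Ĉ_λ(l) [Ĉ_λ(l-k)Ĉ_λ(l) + Ĉ_λ(l)Ĉ_λ(l+k) + Ĉ_λ(l-k)Ĉ_λ(l+k)] dl/(2π)^d`,

"all bounded by `c^{(RW)}_{2,3}/d` by Exerc. 5.4" — Exercise 5.4 being (5.4.6)
`∫ D̂(l)² Ĉ_λ(l)² ½[Ĉ_λ(l+k) + Ĉ_λ(l-k)] dl/(2π)^d ≤ c_{2,3}/d` and (5.4.7)
`∫ D̂(l)² Ĉ_λ(l) Ĉ_λ(l-k) Ĉ_λ(l+k) dl/(2π)^d ≤ c_{2,3}/d`, uniformly in `λ ≤ 1` and `k`. We PROVE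
the common generalisation: for `d ≥ 7`, `λ ∈ [0,1]` and ANY two shifts `a, b ∈ ℝ^d`,

* `integral_Dhat_sq_mul_Chat_triple_le` —
  **`∫_{[-π,π]^d} D̂(l)² Ĉ_λ(l) Ĉ_λ(l+a) Ĉ_λ(l+b) dl ≤ (2π)^d · 2^{22}/d`**
  ((5.4.7) is `a = -k, b = k`; (5.4.6) is `b = 0`), and
* `integral_Chat_triple_le` — **`∫_{[-π,π]^d} Ĉ_λ(l) Ĉ_λ(l+a) Ĉ_λ(l+b) dl ≤ (2π)^d · 2^{22}`**
  (the shape behind (8.3.30), where no factor `1/d` is needed),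

with `integrable_…` companions and the general weighted `[0,∞]` form
`HvdH2017Prop55.lintegral_weight_mul_Chat_triple_le`.

## Proof

Not the printed hint (the identity (5.4.8) and Cauchy–Schwarz), but the region split of
`HvdHRandomWalkTriangles.lean` made trilinear by a maximum trick: with `T = {1 - D̂ ≤ 1/16}` and
`x = Ĉ_λ(l)`, `y = Ĉ_λ(l+a)`, `z = Ĉ_λ(l+b)`, let `M = max{x,y,z}`, so `xyz ≤ M³`. If `M ≤ 16` then
`w·xyz ≤ 16³ w`; otherwise the point where `M` is attained lies in (the corresponding translate
of) `T`, because `Ĉ_λ ≤ 16` off `T` (`Chat_le_sixteen`). Hence, pointwise,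
`w·xyz ≤ 16³ w + 𝟙_T(l) x³ + 𝟙_T(l+a) y³ + 𝟙_T(l+b) z³` (`pointwise_trilinear`), and each shell
term integrates to at most `(2π)^d 2^{20} 2^{-d}` by translation invariance
(`lintegral_shell_Chat_shift_pow_le`), while `∫ D̂² = (2π)^d/(2d)`.

## References

* M. Heydenreich, R. van der Hofstad, *Progress in High-Dimensional Percolation and Random
  Graphs* (Springer 2017): Exercise 5.4 ((5.4.6)–(5.4.8)), Lemma 8.6 ((8.3.22), (8.3.30)),
  Lemma 8.7 ((8.3.33)), Prop. 5.5.
-/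

noncomputable section

open MeasureTheory Filter Real Literature.Probability.LatticeModels
open Literature.Probability.Percolation
open scoped ENNReal BigOperators

namespace Literature.Barriers.CriticalPhenomena

variable {d : ℕ}

/-! Private local copies of random-walk helper lemmas of `HvdHRandomWalkTriangles.lean` whose ROOT-level
names (`srwStepFT_eq_Dhat`, `measurable_Chat`, `Chat_nonneg`, `Chat_le_sixteen`, `integral_Chat_pow_le`)
clash with `GaussianDominationRouteRandomWalk.lean` (REFEREE v27 C37 = REFEREE-2 R14 / GAPS G19-add) and
are being retired from the root namespace there (the differing ones move to `HvdHRW.*`, the identical ones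
become private); statements and proofs identical, so that this file no longer depends on the clashing
names. Likewise a private copy of `HvdHTorusShift.lean`'s `HvdH2017Prop55.measurableSet_region`, which is
being made private there, and `LaceExpansion.P_univ` (`LaceExpansionFourier.lean`, imported via `HvdHTorusShift`)
in place of `HvdHRandomWalkTriangles`' restating copy `HvdH2017Prop55.P_univ` (made private there). The five lemmas of THIS file that restate (up to normalisation) lemmas of
`GaussianDominationRouteLemma86.lean` — `HvdH2017Prop55.mem_region_of_sixteen_lt` (≡ `mem_regionT_of_sixteen_lt`),
`HvdH2017Prop55.mul_mul_le_max_pow_three` (≡ `mul_mul_le_max_pow_three'`), `HvdH2017Prop55.pointwise_trilinear`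
(≡ `trilinear_pointwise`), `measurable_Chat_triple` (≡ `measurable_Chat_triple'`), `Chat_triple_nonneg`
(≡ `Chat_triple_nonneg'`) — are now `private`: they have no user outside this file, and `Lemma86` itself
cannot be imported here before the root-name clash is gone (it imports `GaussianDominationRouteRandomWalk`).
Step 2 of 4 of the lean2-g9 sequence LargeD → Shifted → TorusShift → Triangles; every other public
declaration of this file is unchanged in name, statement and proof. -/

/-- The two spellings of `D̂` agree (local copy of `HvdHRandomWalkTriangles`' lemma). [folklore] -/
private theorem srwStepFT_eq_DhatRW (k : Fin d → ℝ) : srwStepFT d k = Dhat d k := rfl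

/-- `Ĉ_λ` is measurable (local copy). [folklore] -/
private theorem measurable_ChatRW (d : ℕ) (lam : ℝ) : Measurable (Chat d lam) := by
  have h : Measurable fun k : Fin d → ℝ => 1 - lam * Dhat d k :=
    measurable_const.sub (measurable_const.mul (continuous_Dhat d).measurable)
  have : (Chat d lam) = fun k => 1 / (1 - lam * Dhat d k) := funext fun k => rfl
  rw [this]
  exact h.const_div 1

/-- `Ĉ_λ ≥ 0` for `λ ∈ [0,1]` (local copy). [cite: HeydenreichVanDerHofstad2017, (8.2.2)] -/
private theorem Chat_nonnegRW {lam : ℝ} (hl0 : 0 ≤ lam) (hl1 : lam ≤ 1) (k : Fin d → ℝ) :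
    0 ≤ Chat d lam k := by
  have h1 : lam * Dhat d k ≤ 1 := by nlinarith [Dhat_le_one k, neg_one_le_Dhat k]
  rw [Chat]
  exact div_nonneg zero_le_one (by linarith)

/-- Off the shells `Ĉ_λ ≤ 16` (local copy). [cite: HeydenreichVanDerHofstad2017, (5.4.2)] -/
private theorem Chat_le_sixteenRW {lam : ℝ} (hl0 : 0 ≤ lam) (hl1 : lam ≤ 1) {k : Fin d → ℝ}
    (hk : 1 / 16 < 1 - Dhat d k) : Chat d lam k ≤ 16 := by
  have hden : 1 / 16 < 1 - lam * Dhat d k := by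
    rcases le_or_gt 0 (Dhat d k) with hD | hD
    · have : lam * Dhat d k ≤ Dhat d k := by nlinarith
      linarith
    · have : lam * Dhat d k ≤ 0 := by nlinarith
      linarith
  have hpos : 0 < 1 - lam * Dhat d k := by linarith
  rw [Chat, div_le_iff₀ hpos]
  linarith

/-- The region `T = {1 - D̂ ≤ 1/16}` is measurable (private local copy of `HvdHTorusShift.lean`'s
`HvdH2017Prop55.measurableSet_region`). [folklore] -/
private theorem measurableSet_regionRW (d : ℕ) :
    MeasurableSet {k : Fin d → ℝ | 1 - Dhat d k ≤ 1 / 16} :=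
  measurableSet_le (measurable_const.sub (continuous_Dhat d).measurable) measurable_const

namespace HvdH2017Prop55

open Slade2006Prop53

/-- Off the region `T = {1 - D̂ ≤ 1/16}` the Green's function is at most `16`; contrapositive
form: `Ĉ_λ(m) > 16 ⟹ m ∈ T`. [cite: HeydenreichVanDerHofstad2017, (5.4.2)] -/
private theorem mem_region_of_sixteen_lt {lam : ℝ} (hl0 : 0 ≤ lam) (hl1 : lam ≤ 1) {m : Fin d → ℝ}
    (hm : 16 < Chat d lam m) : m ∈ {k : Fin d → ℝ | 1 - Dhat d k ≤ 1 / 16} := by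
  by_contra h
  simp only [Set.mem_setOf_eq, not_le] at h
  linarith [Chat_le_sixteenRW hl0 hl1 h]

/-- For `0 ≤ x, y, z`: `xyz ≤ (max{x,y,z})³`. [folklore] -/
private theorem mul_mul_le_max_pow_three {x y z : ℝ} (hx : 0 ≤ x) (hy : 0 ≤ y) (hz : 0 ≤ z) :
    x * y * z ≤ max x (max y z) ^ 3 := by
  have h1 : x ≤ max x (max y z) := le_max_left _ _
  have h2 : y ≤ max x (max y z) := (le_max_left _ _).trans (le_max_right _ _)
  have h3 : z ≤ max x (max y z) := (le_max_right _ _).trans (le_max_right _ _)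
  calc x * y * z ≤ max x (max y z) * max x (max y z) * max x (max y z) := by
        gcongr
    _ = max x (max y z) ^ 3 := by ring

/-- **The trilinear majorant**: with `T = {1 - D̂ ≤ 1/16}`, `λ ∈ [0,1]`, a weight `0 ≤ w ≤ 1` and
shifts `a, b`: `w Ĉ_λ(l)Ĉ_λ(l+a)Ĉ_λ(l+b) ≤ 16³ w + 𝟙_T(l)Ĉ_λ(l)³ + 𝟙_T(l+a)Ĉ_λ(l+a)³ +
𝟙_T(l+b)Ĉ_λ(l+b)³` (in `[0, ∞]`). [cite: HeydenreichVanDerHofstad2017, Exercise 5.4] -/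
private theorem pointwise_trilinear {lam : ℝ} (hl0 : 0 ≤ lam) (hl1 : lam ≤ 1) {w : ℝ} (hw0 : 0 ≤ w)
    (hw1 : w ≤ 1) (l a b : Fin d → ℝ) :
    ENNReal.ofReal (w * (Chat d lam l * Chat d lam (l + a) * Chat d lam (l + b))) ≤
      16 ^ 3 * ENNReal.ofReal w +
        {k : Fin d → ℝ | 1 - Dhat d k ≤ 1 / 16}.indicator
          (fun k => ENNReal.ofReal (Chat d lam k ^ 3)) l +
        {k : Fin d → ℝ | 1 - Dhat d k ≤ 1 / 16}.indicator
          (fun k => ENNReal.ofReal (Chat d lam k ^ 3)) (l + a) +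
        {k : Fin d → ℝ | 1 - Dhat d k ≤ 1 / 16}.indicator
          (fun k => ENNReal.ofReal (Chat d lam k ^ 3)) (l + b) := by
  set T := {k : Fin d → ℝ | 1 - Dhat d k ≤ 1 / 16} with hT
  set x := Chat d lam l with hx
  set y := Chat d lam (l + a) with hy
  set z := Chat d lam (l + b) with hz
  have hx0 : 0 ≤ x := Chat_nonnegRW hl0 hl1 _
  have hy0 : 0 ≤ y := Chat_nonnegRW hl0 hl1 _
  have hz0 : 0 ≤ z := Chat_nonnegRW hl0 hl1 _
  set M := max x (max y z) with hM
  have hprod : x * y * z ≤ M ^ 3 := mul_mul_le_max_pow_three hx0 hy0 hz0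
  have hwprod : w * (x * y * z) ≤ M ^ 3 := by
    calc w * (x * y * z) ≤ 1 * (x * y * z) :=
          mul_le_mul_of_nonneg_right hw1 (mul_nonneg (mul_nonneg hx0 hy0) hz0)
      _ ≤ M ^ 3 := by rw [one_mul]; exact hprod
  by_cases hM16 : M ≤ 16
  · -- all three values are `≤ 16`
    have h : w * (x * y * z) ≤ 16 ^ 3 * w := by
      have : x * y * z ≤ 16 ^ 3 :=
        hprod.trans (pow_le_pow_left₀ (le_trans hx0 (le_max_left _ _)) hM16 3)
      nlinarith
    calc ENNReal.ofReal (w * (x * y * z)) ≤ ENNReal.ofReal (16 ^ 3 * w) :=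
          ENNReal.ofReal_le_ofReal h
      _ = 16 ^ 3 * ENNReal.ofReal w := by
          rw [ENNReal.ofReal_mul (by positivity), ENNReal.ofReal_pow (by norm_num),
            ENNReal.ofReal_ofNat]
      _ ≤ _ := by
          rw [add_assoc, add_assoc]
          exact le_self_add
  · have hM16' : 16 < M := not_le.1 hM16
    have hbound : ENNReal.ofReal (w * (x * y * z)) ≤ ENNReal.ofReal (M ^ 3) :=
      ENNReal.ofReal_le_ofReal hwprod
    -- locate where the maximum is attained
    rcases max_choice x (max y z) with h1 | h23
    · -- `M = x`: `l ∈ T`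
      have hl : l ∈ T := mem_region_of_sixteen_lt hl0 hl1 (by rw [← hx, ← h1]; exact hM16')
      calc ENNReal.ofReal (w * (x * y * z)) ≤ ENNReal.ofReal (M ^ 3) := hbound
        _ = ENNReal.ofReal (x ^ 3) := by rw [hM, h1]
        _ = T.indicator (fun k => ENNReal.ofReal (Chat d lam k ^ 3)) l := by
            rw [Set.indicator_of_mem hl]
        _ ≤ _ := by
            calc T.indicator (fun k => ENNReal.ofReal (Chat d lam k ^ 3)) l
                ≤ 16 ^ 3 * ENNReal.ofReal w +
                    T.indicator (fun k => ENNReal.ofReal (Chat d lam k ^ 3)) l := le_add_self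
              _ ≤ _ := by rw [add_assoc]; exact le_self_add
    · rcases max_choice y z with h2 | h3
      · -- `M = y`: `l + a ∈ T`
        have hM' : M = y := h23.trans h2
        have hl : l + a ∈ T := mem_region_of_sixteen_lt hl0 hl1 (by rw [← hy, ← hM']; exact hM16')
        calc ENNReal.ofReal (w * (x * y * z)) ≤ ENNReal.ofReal (M ^ 3) := hbound
          _ = ENNReal.ofReal (y ^ 3) := by rw [hM']
          _ = T.indicator (fun k => ENNReal.ofReal (Chat d lam k ^ 3)) (l + a) := by
              rw [Set.indicator_of_mem hl]
          _ ≤ _ := by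
              calc T.indicator (fun k => ENNReal.ofReal (Chat d lam k ^ 3)) (l + a)
                  ≤ (16 ^ 3 * ENNReal.ofReal w +
                      T.indicator (fun k => ENNReal.ofReal (Chat d lam k ^ 3)) l) +
                      T.indicator (fun k => ENNReal.ofReal (Chat d lam k ^ 3)) (l + a) :=
                    le_add_self
                _ ≤ _ := le_self_add
      · -- `M = z`: `l + b ∈ T`
        have hM' : M = z := h23.trans h3
        have hl : l + b ∈ T := mem_region_of_sixteen_lt hl0 hl1 (by rw [← hz, ← hM']; exact hM16')
        calc ENNReal.ofReal (w * (x * y * z)) ≤ ENNReal.ofReal (M ^ 3) := hbound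
          _ = ENNReal.ofReal (z ^ 3) := by rw [hM']
          _ = T.indicator (fun k => ENNReal.ofReal (Chat d lam k ^ 3)) (l + b) := by
              rw [Set.indicator_of_mem hl]
          _ ≤ _ := le_add_self

/-- **Exercise 5.4 with a general weight**, in `[0, ∞]`: for `d ≥ 7`, `λ ∈ [0,1]`, a measurable
weight `0 ≤ w ≤ 1` and shifts `a, b`,
`∫ w(l) Ĉ_λ(l)Ĉ_λ(l+a)Ĉ_λ(l+b) dl ≤ 16³ ∫ w + 3 (2π)^d 2^{20} 2^{-d}`.
[cite: HeydenreichVanDerHofstad2017, Exercise 5.4 ((5.4.6)–(5.4.7))] -/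
theorem lintegral_weight_mul_Chat_triple_le (hd : 7 ≤ d) {lam : ℝ} (hl0 : 0 ≤ lam) (hl1 : lam ≤ 1)
    {w : (Fin d → ℝ) → ℝ} (hwm : Measurable w) (hw0 : ∀ k, 0 ≤ w k) (hw1 : ∀ k, w k ≤ 1)
    (a b : Fin d → ℝ) :
    ∫⁻ l, ENNReal.ofReal (w l * (Chat d lam l * Chat d lam (l + a) * Chat d lam (l + b))) ∂P d ≤
      16 ^ 3 * ∫⁻ l, ENNReal.ofReal (w l) ∂P d +
        3 * ENNReal.ofReal ((2 * π) ^ d * 2 ^ 20 * (1 / 2) ^ d) := by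
  have hd3 : 2 * 3 + 1 ≤ d := by omega
  set T := {k : Fin d → ℝ | 1 - Dhat d k ≤ 1 / 16} with hT
  set G : (Fin d → ℝ) → ℝ≥0∞ := T.indicator fun k => ENNReal.ofReal (Chat d lam k ^ 3) with hG
  have hGm : Measurable G :=
    (((measurable_ChatRW d lam).pow_const 3).ennreal_ofReal).indicator (measurableSet_regionRW d)
  have hwm' : Measurable fun l => ENNReal.ofReal (w l) := hwm.ennreal_ofReal
  have hshell : ∀ s : Fin d → ℝ, ∫⁻ l, G (l + s) ∂P d ≤
      ENNReal.ofReal ((2 * π) ^ d * 2 ^ 20 * (1 / 2) ^ d) := fun s => by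
    have h := lintegral_shell_Chat_shift_pow_le 3 hd3 hl0 hl1 s
    exact h
  have hshell0 : ∫⁻ l, G l ∂P d ≤ ENNReal.ofReal ((2 * π) ^ d * 2 ^ 20 * (1 / 2) ^ d) := by
    simpa using hshell 0
  calc ∫⁻ l, ENNReal.ofReal (w l * (Chat d lam l * Chat d lam (l + a) * Chat d lam (l + b))) ∂P d
      ≤ ∫⁻ l, (16 ^ 3 * ENNReal.ofReal (w l) + G l + G (l + a) + G (l + b)) ∂P d :=
        lintegral_mono fun l => pointwise_trilinear hl0 hl1 (hw0 l) (hw1 l) l a b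
    _ = 16 ^ 3 * ∫⁻ l, ENNReal.ofReal (w l) ∂P d + ∫⁻ l, G l ∂P d + ∫⁻ l, G (l + a) ∂P d +
          ∫⁻ l, G (l + b) ∂P d := by
        have hGa : Measurable fun l => G (l + a) := hGm.comp (measurable_add_const a)
        have hGb : Measurable fun l => G (l + b) := hGm.comp (measurable_add_const b)
        rw [lintegral_add_right _ hGb, lintegral_add_right _ hGa, lintegral_add_right _ hGm,
          lintegral_const_mul _ hwm']
    _ ≤ 16 ^ 3 * ∫⁻ l, ENNReal.ofReal (w l) ∂P d +
          ENNReal.ofReal ((2 * π) ^ d * 2 ^ 20 * (1 / 2) ^ d) +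
          ENNReal.ofReal ((2 * π) ^ d * 2 ^ 20 * (1 / 2) ^ d) +
          ENNReal.ofReal ((2 * π) ^ d * 2 ^ 20 * (1 / 2) ^ d) :=
        add_le_add (add_le_add (add_le_add le_rfl hshell0) (hshell a)) (hshell b)
    _ = _ := by ring

/-- The case `w = D̂²`, in `[0, ∞]`: `∫ D̂² Ĉ_λ(l)Ĉ_λ(l+a)Ĉ_λ(l+b) dl ≤ (2π)^d 2^{22}/d` (`d ≥ 7`,
`λ ∈ [0,1]`). [cite: HeydenreichVanDerHofstad2017, Exercise 5.4 ((5.4.6)–(5.4.7))] -/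
theorem lintegral_Dhat_sq_mul_Chat_triple_le (hd : 7 ≤ d) {lam : ℝ} (hl0 : 0 ≤ lam)
    (hl1 : lam ≤ 1) (a b : Fin d → ℝ) :
    ∫⁻ l, ENNReal.ofReal (Dhat d l ^ 2 *
        (Chat d lam l * Chat d lam (l + a) * Chat d lam (l + b))) ∂P d ≤
      ENNReal.ofReal ((2 * π) ^ d * 2 ^ 22 / d) := by
  have hd1 : 1 ≤ d := le_trans (by norm_num) hd
  have hdpos : (0 : ℝ) < d := by exact_mod_cast (show 0 < d by omega)
  have h := lintegral_weight_mul_Chat_triple_le hd hl0 hl1 (w := fun k => Dhat d k ^ 2)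
    ((continuous_Dhat d).measurable.pow_const 2) (fun k => sq_nonneg _)
    (fun k => by rw [← srwStepFT_eq_DhatRW]; exact srwStepFT_sq_le_one k) a b
  have e0 : ∫⁻ k, ENNReal.ofReal (Dhat d k ^ 2) ∂P d = ENNReal.ofReal ((2 * π) ^ d / (2 * d)) :=
    lintegral_srwStepFT_sq hd1
  rw [e0] at h
  have e : (16 : ℝ≥0∞) ^ 3 * ENNReal.ofReal ((2 * π) ^ d / (2 * d)) +
      3 * ENNReal.ofReal ((2 * π) ^ d * 2 ^ 20 * (1 / 2) ^ d) =
      ENNReal.ofReal (16 ^ 3 * ((2 * π) ^ d / (2 * d)) +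
        3 * ((2 * π) ^ d * 2 ^ 20 * (1 / 2) ^ d)) := by
    rw [ENNReal.ofReal_add (by positivity) (by positivity),
      ENNReal.ofReal_mul (p := (16 : ℝ) ^ 3) (by positivity),
      ENNReal.ofReal_pow (p := (16 : ℝ)) (by norm_num), ENNReal.ofReal_ofNat,
      ENNReal.ofReal_mul (p := (3 : ℝ)) (by positivity), ENNReal.ofReal_ofNat]
  rw [e] at h
  refine h.trans (ENNReal.ofReal_le_ofReal ?_)
  have h1 : (1 / 2 : ℝ) ^ d ≤ 1 / d := by
    rw [one_div_pow, one_div_le_one_div (by positivity) hdpos]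
    exact_mod_cast Nat.lt_two_pow_self.le
  have hπ : 0 ≤ (2 * π) ^ d := by positivity
  calc (16 : ℝ) ^ 3 * ((2 * π) ^ d / (2 * d)) + 3 * ((2 * π) ^ d * 2 ^ 20 * (1 / 2) ^ d)
      ≤ (16 : ℝ) ^ 3 * ((2 * π) ^ d / (2 * d)) + 3 * ((2 * π) ^ d * 2 ^ 20 * (1 / d)) := by
        gcongr
    _ = (2 * π) ^ d * (2 ^ 11 + 3 * 2 ^ 20) / d := by field_simp; ring
    _ ≤ (2 * π) ^ d * 2 ^ 22 / d := by gcongr; norm_num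

/-- The case `w = 1`, in `[0, ∞]`: `∫ Ĉ_λ(l)Ĉ_λ(l+a)Ĉ_λ(l+b) dl ≤ (2π)^d 2^{22}` (`d ≥ 7`,
`λ ∈ [0,1]`). [cite: HeydenreichVanDerHofstad2017, (8.3.30) and Exercise 5.4] -/
theorem lintegral_Chat_triple_le (hd : 7 ≤ d) {lam : ℝ} (hl0 : 0 ≤ lam) (hl1 : lam ≤ 1)
    (a b : Fin d → ℝ) :
    ∫⁻ l, ENNReal.ofReal (Chat d lam l * Chat d lam (l + a) * Chat d lam (l + b)) ∂P d ≤
      ENNReal.ofReal ((2 * π) ^ d * 2 ^ 22) := by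
  have h := lintegral_weight_mul_Chat_triple_le hd hl0 hl1 (w := fun _ => (1 : ℝ))
    measurable_const (fun _ => zero_le_one) (fun _ => le_rfl) a b
  simp only [one_mul, ENNReal.ofReal_one, lintegral_const, one_mul] at h
  rw [LaceExpansion.P_univ] at h   -- `LaceExpansionFourier`'s (via `HvdHTorusShift`); `HvdH2017Prop55.P_univ` of `HvdHRandomWalkTriangles` restates it and is being made private there (C37 step 4)
  have e : (16 : ℝ≥0∞) ^ 3 * ENNReal.ofReal ((2 * π) ^ d) +
      3 * ENNReal.ofReal ((2 * π) ^ d * 2 ^ 20 * (1 / 2) ^ d) =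
      ENNReal.ofReal (16 ^ 3 * (2 * π) ^ d + 3 * ((2 * π) ^ d * 2 ^ 20 * (1 / 2) ^ d)) := by
    rw [ENNReal.ofReal_add (by positivity) (by positivity),
      ENNReal.ofReal_mul (p := (16 : ℝ) ^ 3) (by positivity),
      ENNReal.ofReal_pow (p := (16 : ℝ)) (by norm_num), ENNReal.ofReal_ofNat,
      ENNReal.ofReal_mul (p := (3 : ℝ)) (by positivity), ENNReal.ofReal_ofNat]
  rw [e] at h
  refine h.trans (ENNReal.ofReal_le_ofReal ?_)
  have h1 : (1 / 2 : ℝ) ^ d ≤ 1 := pow_le_one₀ (by norm_num) (by norm_num)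
  have hπ : 0 ≤ (2 * π) ^ d := by positivity
  calc (16 : ℝ) ^ 3 * (2 * π) ^ d + 3 * ((2 * π) ^ d * 2 ^ 20 * (1 / 2) ^ d)
      ≤ (16 : ℝ) ^ 3 * (2 * π) ^ d + 3 * ((2 * π) ^ d * 2 ^ 20 * 1) := by gcongr
    _ = (2 * π) ^ d * (2 ^ 12 + 3 * 2 ^ 20) := by ring
    _ ≤ (2 * π) ^ d * 2 ^ 22 := by gcongr; norm_num

end HvdH2017Prop55

/-! ### The trilinear bounds as real integrals -/

open Slade2006Prop53 in
/-- The integrand of (5.4.6)–(5.4.7)/(8.3.22) is measurable. [folklore] -/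
private theorem measurable_Chat_triple (lam : ℝ) (a b : Fin d → ℝ) :
    Measurable fun l => Chat d lam l * Chat d lam (l + a) * Chat d lam (l + b) :=
  ((measurable_ChatRW d lam).mul ((measurable_ChatRW d lam).comp (measurable_add_const a))).mul
    ((measurable_ChatRW d lam).comp (measurable_add_const b))

/-- The integrand of (5.4.6)–(5.4.7)/(8.3.22) is nonnegative for `λ ∈ [0,1]`. [folklore] -/
private theorem Chat_triple_nonneg {lam : ℝ} (hl0 : 0 ≤ lam) (hl1 : lam ≤ 1) (l a b : Fin d → ℝ) :
    0 ≤ Chat d lam l * Chat d lam (l + a) * Chat d lam (l + b) :=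
  mul_nonneg (mul_nonneg (Chat_nonnegRW hl0 hl1 _) (Chat_nonnegRW hl0 hl1 _)) (Chat_nonnegRW hl0 hl1 _)

open Slade2006Prop53 in
/-- `D̂² Ĉ_λ(l)Ĉ_λ(l+a)Ĉ_λ(l+b)` is integrable on the cube (`d ≥ 7`, `λ ∈ [0,1]`).
[cite: HeydenreichVanDerHofstad2017, Exercise 5.4] -/
theorem integrable_Dhat_sq_mul_Chat_triple (hd : 7 ≤ d) {lam : ℝ} (hl0 : 0 ≤ lam) (hl1 : lam ≤ 1)
    (a b : Fin d → ℝ) :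
    Integrable (fun l => Dhat d l ^ 2 * (Chat d lam l * Chat d lam (l + a) * Chat d lam (l + b)))
      (P d) := by
  refine ⟨(((continuous_Dhat d).measurable.pow_const 2).mul
    (measurable_Chat_triple lam a b)).aestronglyMeasurable, ?_⟩
  rw [hasFiniteIntegral_iff_ofReal (ae_of_all _ fun l =>
    mul_nonneg (sq_nonneg _) (Chat_triple_nonneg hl0 hl1 l a b))]
  exact lt_of_le_of_lt (HvdH2017Prop55.lintegral_Dhat_sq_mul_Chat_triple_le hd hl0 hl1 a b)
    ENNReal.ofReal_lt_top

open Slade2006Prop53 in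
/-- **Exercise 5.4 / the random-walk input of (8.3.22)**: for `d ≥ 7`, `λ ∈ [0,1]` and any two
shifts `a, b ∈ ℝ^d`, `∫_{[-π,π]^d} D̂(l)² Ĉ_λ(l) Ĉ_λ(l+a) Ĉ_λ(l+b) dl ≤ (2π)^d · 2^{22}/d`;
(5.4.7) is the case `a = -k`, `b = k`, and (5.4.6) the case `b = 0` (`Ĉ_λ(l)² Ĉ_λ(l ± k)`).
[cite: HeydenreichVanDerHofstad2017, Exercise 5.4 ((5.4.6)–(5.4.7)) and (8.3.22)] -/
theorem integral_Dhat_sq_mul_Chat_triple_le (hd : 7 ≤ d) {lam : ℝ} (hl0 : 0 ≤ lam)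
    (hl1 : lam ≤ 1) (a b : Fin d → ℝ) :
    ∫ l, Dhat d l ^ 2 * (Chat d lam l * Chat d lam (l + a) * Chat d lam (l + b)) ∂P d ≤
      (2 * π) ^ d * 2 ^ 22 / d := by
  rw [integral_eq_lintegral_of_nonneg_ae (ae_of_all _ fun l =>
      mul_nonneg (sq_nonneg _) (Chat_triple_nonneg hl0 hl1 l a b))
    (((continuous_Dhat d).measurable.pow_const 2).mul
      (measurable_Chat_triple lam a b)).aestronglyMeasurable]
  exact ENNReal.toReal_le_of_le_ofReal (by positivity)
    (HvdH2017Prop55.lintegral_Dhat_sq_mul_Chat_triple_le hd hl0 hl1 a b)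

open Slade2006Prop53 in
/-- `Ĉ_λ(l)Ĉ_λ(l+a)Ĉ_λ(l+b)` is integrable on the cube (`d ≥ 7`, `λ ∈ [0,1]`).
[cite: HeydenreichVanDerHofstad2017, (8.3.30)] -/
theorem integrable_Chat_triple (hd : 7 ≤ d) {lam : ℝ} (hl0 : 0 ≤ lam) (hl1 : lam ≤ 1)
    (a b : Fin d → ℝ) :
    Integrable (fun l => Chat d lam l * Chat d lam (l + a) * Chat d lam (l + b)) (P d) := by
  refine ⟨(measurable_Chat_triple lam a b).aestronglyMeasurable, ?_⟩
  rw [hasFiniteIntegral_iff_ofReal (ae_of_all _ fun l => Chat_triple_nonneg hl0 hl1 l a b)]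
  exact lt_of_le_of_lt (HvdH2017Prop55.lintegral_Chat_triple_le hd hl0 hl1 a b)
    ENNReal.ofReal_lt_top

open Slade2006Prop53 in
/-- **The random-walk input of (8.3.30)**: for `d ≥ 7`, `λ ∈ [0,1]` and any two shifts
`a, b ∈ ℝ^d`, `∫_{[-π,π]^d} Ĉ_λ(l) Ĉ_λ(l+a) Ĉ_λ(l+b) dl ≤ (2π)^d · 2^{22}` (no factor `1/d` is
needed there). [cite: HeydenreichVanDerHofstad2017, (8.3.30) and Exercise 5.4] -/
theorem integral_Chat_triple_le (hd : 7 ≤ d) {lam : ℝ} (hl0 : 0 ≤ lam) (hl1 : lam ≤ 1)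
    (a b : Fin d → ℝ) :
    ∫ l, Chat d lam l * Chat d lam (l + a) * Chat d lam (l + b) ∂P d ≤ (2 * π) ^ d * 2 ^ 22 := by
  rw [integral_eq_lintegral_of_nonneg_ae (ae_of_all _ fun l => Chat_triple_nonneg hl0 hl1 l a b)
    (measurable_Chat_triple lam a b).aestronglyMeasurable]
  exact ENNReal.toReal_le_of_le_ofReal (by positivity)
    (HvdH2017Prop55.lintegral_Chat_triple_le hd hl0 hl1 a b)

end Literature.Barriers.CriticalPhenomena

end
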